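import Literature.MathematicalPhysics.QuantumLattice.TorusSectorPressureTypeBoundAllTori
import Literature.MathematicalPhysics.QuantumLattice.HubbardThermalAxisWindow
import HarnessLib

/-!
# Thermal energy windows from a C2 (type-class) certificate at `β` and a C1 (Markov) certificate — for EVERY
# torus limit of the convention of record (no box-compatibility of the side sequence)

Family `hubbard` (topic `MathematicalPhysics/QuantumLattice`); the all-tori versions of the two T-axis window
theorems of `HubbardThermalAxisWindow` (§2 there:
`IsTorusLimitOfMixture.meanEnergy_hubbardTTPrime_le_of_typeClass_of_rectMarkovCertificate` and
`…le_meanEnergy_hubbardTTPrime_of_typeClass_of_rectMarkovCertificate`). Those take the C2 pressure floor from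
`InfVolFermionState.eventually_typeFreeEntropy_mul_sq_le_log_partitionFn`, whose hypothesis `hbox` restricts the side
sequence to box-compatible tori (`Ls j = K_x a = K_y b`, `K_x K_y = R q`, `halfRectN n (Ls j) = R A₀`); the words so
obtained bind only that sub-class of torus limits. Here the floor comes from
`InfVolFermionState.eventually_typeFreeEntropy_mul_sq_le_log_partitionFn_allTori` (`TorusSectorPressureTypeBoundAllTori`)
instead, so the SAME window holds for every torus limit along every `Ls → ∞` — the shape the downstream readers
(`∀ Ls ω, Tendsto Ls atTop atTop → ω.IsTorusLimitOfMixture … Ls → …`) quantify over. The only change of data: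
`hbox` is replaced by the density identity `n · (q a b) = 2 A₀` (and `n ≤ 2`).

* `IsTorusLimitOfMixture.meanEnergy_hubbardTTPrime_le_of_typeClass_of_rectMarkovCertificate_allTori` — upper edge
  `e_Φ(ω) ≤ ((c − β_h μ n) − W)/(β − β_h)` from C2 at `β` and a rectangle C1 certificate at `β_h < β`;
* `IsTorusLimitOfMixture.le_meanEnergy_hubbardTTPrime_of_typeClass_of_rectMarkovCertificate_allTori` — lower edge
  `(W − (c − β_c μ n))/(β_c − β) ≤ e_Φ(ω)` from C2 at `β` and a rectangle C1 certificate at `β_c > β`;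
  `W = (q log q − Σ_s m_s log m_s + Σ_s m_s log z_s)/(q a b)`.

Everything is PROVED; no definition, no named fact.

## References

* R. B. Israel, *Convexity in the Theory of Lattice Gases* (1979), Lemma II.3.1. [cite: Israel1979, Lemma II.3.1]
* D. Poulin, M. B. Hastings, Phys. Rev. Lett. 106 (2011) 080403, eqs. (3)–(8). [cite: PoulinHastings2011, eqs. (3)–(8)]
* D. Ruelle, *Statistical Mechanics: Rigorous Results* (1969), §3.3. [cite: Ruelle1969, §3.3]
-/

noncomputable section

namespace Literature.MathematicalPhysics.QuantumLattice

open Matrix Finset HubbardWave0 ThermodynamicLimit LiebThm1 AndersonCluster Literature.Probability.LatticeModels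
open _root_.Filter
open scoped _root_.Topology ComplexOrder BigOperators

namespace InfVolFermionState

variable {t U n β : ℝ} {ω : InfVolFermionState 2} {Ls : ℕ → ℕ}

/-- **Upper edge of the thermal energy window from a C2 certificate at `β` and a C1 certificate at `β_h < β`,
EVERY torus limit** (square-lattice Hubbard model, `t' = 0`). C2 data: box `a × b`, sectors `S`, balanced base
type `m` supported in `S` (`Σ m_s = q ≥ 1`, `Σ m_s a_s = Σ m_s b_s = A₀`) of density `n = 2A₀/(q a b) ≤ 2`, floors
`0 < z_s ≤ Re Z_β(H^open_{a×b}; s)`; the torus limit `ω` is taken along ANY `Ls → ∞`. C1 data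
(`HubbardTorusMarkovRectWindow`): rectangle `a' × b'` (`a', b' ≥ 2`) at `(β_h, μ)` with annihilator, dual `L_B` and
constant `c`. Then `e_Φ(ω) ≤ ((c − β_h μ n) − W)/(β − β_h)`, `W = (q log q − Σ m_s log m_s + Σ m_s log z_s)/(q a b)`.
[cite: Israel1979, Lemma II.3.1] [cite: PoulinHastings2011, eqs. (3)–(8)] [cite: Ruelle1969, §3.3] -/
theorem IsTorusLimitOfMixture.meanEnergy_hubbardTTPrime_le_of_typeClass_of_rectMarkovCertificate_allTori
    (hn0 : 0 ≤ n) (hn2 : n ≤ 2)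
    (h : ω.IsTorusLimitOfMixture (sectorGibbsCount n) (fun L => sectorGibbsWeightTT' β t 0 U n L)
      (fun L => sectorGibbsVectorTT' t 0 U n L) Ls)
    (hLs : Tendsto Ls atTop atTop) {βh : ℝ} (hβh : 0 < βh) (hlt : βh < β)
    -- C2 at `β`
    {a b : ℕ} (ha : 1 ≤ a) (hb : 1 ≤ b) (S : Finset (ℕ × ℕ)) (m : ℕ × ℕ → ℕ) {q A₀ : ℕ} (hq : 1 ≤ q)
    (hmS : ∀ s, m s ≠ 0 → s ∈ S) (hsum : ∑ s ∈ S, m s = q) (hA : ∑ s ∈ S, m s * s.1 = A₀)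
    (hB : ∑ s ∈ S, m s * s.2 = A₀) (hn : n * ((q : ℝ) * a * b) = 2 * A₀) {z : ℕ × ℕ → ℝ}
    (hz0 : ∀ s ∈ S, 0 < z s)
    (hz : ∀ s ∈ S, z s ≤ (partitionFn β (spinSectorHamiltonian s.1 s.2 (hubbardOpenBoxTT' a b t 0 U))).re)
    -- C1 at `βh`
    (μ : ℝ) {a' b' : ℕ} (ha' : 2 ≤ a') (hb' : 2 ≤ b')
    {ι : Type*} (sι : Finset ι) (Sw : ι → Finset (Site 2)) (hS : ∀ i, Sw i ⊆ rectWindow a' b') (zw : ι → Site 2)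
    (hzw : ∀ i, shiftSet (zw i) (Sw i) ⊆ rectWindow a' b') {O : ∀ i, FermionOp (Sw i)}
    (hO : ∀ i ∈ sι, (O i).IsHermitian) (g : ι → ℝ)
    {LB : FermionOp ((rectWindow a' b').erase (mkSite2 (a' - 1) (b' - 1)))} (hLB : LB.IsHermitian) {c : ℝ}
    (hcert : ((Real.exp c : ℂ) • cfc Real.exp LB -
      fermionPartialTrace (PolySite.incl (Finset.erase_subset (mkSite2 (a' - 1) (b' - 1)) (rectWindow a' b')))
        (cfc Real.exp (-((βh : ℂ) • (cornerEnergyRep (rectWindow a' b') (mkSite2 (a' - 1) (b' - 1)) t U μ +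
            windowAnnihilator sι (rectWindow a' b') Sw hS zw hzw O g)) +
          fermionEmbed (PolySite.incl (Finset.erase_subset (mkSite2 (a' - 1) (b' - 1)) (rectWindow a' b'))) LB))).PosSemidef) :
    ω.meanEnergy (hubbardTTPrimeFermionInteraction t 0 U) 1 ≤
      ((c - βh * μ * n) - ((q : ℝ) * Real.log q - ∑ s ∈ S, (m s : ℝ) * Real.log (m s) +
        ∑ s ∈ S, (m s : ℝ) * Real.log (z s)) / ((q : ℝ) * a * b)) / (β - βh) := by
  have hβ : 0 ≤ β := (hβh.trans hlt).le
  refine h.meanEnergy_hubbardTTPrime_le_of_eventually_pressure_bounds hn0 hn2 hLs hβh hlt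
    (fun ε hε => eventually_typeFreeEntropy_mul_sq_le_log_partitionFn_allTori t 0 U n hβ ha hb S m hq hmS hsum
      hA hB hn hn2 hz0 hz hLs hε)
    (fun ε hε => ?_)
  have hKTI : ∀ (L : ℕ) [NeZero L], ∀ w : TorusSite 2 L,
      relabel (Orb.translate w) (hubbardTorusTT' L t 0 U - (μ : ℂ) • totalNumber) =
        hubbardTorusTT' L t 0 U - (μ : ℂ) • totalNumber := fun L _ w => by
    rw [hubbardTorusTT'_zero_sub_mu, relabel_translate_hubbardTorusWith]
  exact eventually_log_partitionFn_sectorHamiltonianTT'_le_of_clusterCertificate t U μ βh hn0 hn2 hLs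
    (rectCorner_mem_rectWindow (by omega) (by omega)) toLex_le_toLex_rectCorner
    (rectWindow_subset_halfOpenBox_max a' b')
    (fun i => bondWeightSum_cornerBondWeight (rectCorner_mem_rectWindow (by omega) (by omega))
      (rectCorner_sub_unitVec_mem_rectWindow ha' hb' i))
    (siteWeightSum_cornerSiteWeight (rectCorner_mem_rectWindow (by omega) (by omega)))
    (siteWeightSum_mul_cornerSiteWeight (rectCorner_mem_rectWindow (by omega) (by omega)) (-μ))
    (isHermitian_windowAnnihilator sι _ Sw hS zw hzw hO g)
    (fun L _ hL3 hℓL => trace_window_mul_windowAnnihilator (relabel_translate_gibbsDensity L (hKTI L) βh)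
      _ sι Sw hS zw hzw O g) hLB hcert hε

/-- **Lower edge of the thermal energy window from a C2 certificate at `β` and a C1 certificate at a colder
`β_c > β`, EVERY torus limit** (same data with the C1 certificate at `(β_c, μ)`):
`(W − (c − β_c μ n))/(β_c − β) ≤ e_Φ(ω)`. [cite: Israel1979, Lemma II.3.1] [cite: PoulinHastings2011, eqs. (3)–(8)]
[cite: Ruelle1969, §3.3] -/
theorem IsTorusLimitOfMixture.le_meanEnergy_hubbardTTPrime_of_typeClass_of_rectMarkovCertificate_allTori
    (hn0 : 0 ≤ n) (hn2 : n ≤ 2)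
    (h : ω.IsTorusLimitOfMixture (sectorGibbsCount n) (fun L => sectorGibbsWeightTT' β t 0 U n L)
      (fun L => sectorGibbsVectorTT' t 0 U n L) Ls)
    (hLs : Tendsto Ls atTop atTop) (hβ : 0 < β) {βc : ℝ} (hlt : β < βc)
    -- C2 at `β`
    {a b : ℕ} (ha : 1 ≤ a) (hb : 1 ≤ b) (S : Finset (ℕ × ℕ)) (m : ℕ × ℕ → ℕ) {q A₀ : ℕ} (hq : 1 ≤ q)
    (hmS : ∀ s, m s ≠ 0 → s ∈ S) (hsum : ∑ s ∈ S, m s = q) (hA : ∑ s ∈ S, m s * s.1 = A₀)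
    (hB : ∑ s ∈ S, m s * s.2 = A₀) (hn : n * ((q : ℝ) * a * b) = 2 * A₀) {z : ℕ × ℕ → ℝ}
    (hz0 : ∀ s ∈ S, 0 < z s)
    (hz : ∀ s ∈ S, z s ≤ (partitionFn β (spinSectorHamiltonian s.1 s.2 (hubbardOpenBoxTT' a b t 0 U))).re)
    -- C1 at `βc`
    (μ : ℝ) {a' b' : ℕ} (ha' : 2 ≤ a') (hb' : 2 ≤ b')
    {ι : Type*} (sι : Finset ι) (Sw : ι → Finset (Site 2)) (hS : ∀ i, Sw i ⊆ rectWindow a' b') (zw : ι → Site 2)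
    (hzw : ∀ i, shiftSet (zw i) (Sw i) ⊆ rectWindow a' b') {O : ∀ i, FermionOp (Sw i)}
    (hO : ∀ i ∈ sι, (O i).IsHermitian) (g : ι → ℝ)
    {LB : FermionOp ((rectWindow a' b').erase (mkSite2 (a' - 1) (b' - 1)))} (hLB : LB.IsHermitian) {c : ℝ}
    (hcert : ((Real.exp c : ℂ) • cfc Real.exp LB -
      fermionPartialTrace (PolySite.incl (Finset.erase_subset (mkSite2 (a' - 1) (b' - 1)) (rectWindow a' b')))
        (cfc Real.exp (-((βc : ℂ) • (cornerEnergyRep (rectWindow a' b') (mkSite2 (a' - 1) (b' - 1)) t U μ +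
            windowAnnihilator sι (rectWindow a' b') Sw hS zw hzw O g)) +
          fermionEmbed (PolySite.incl (Finset.erase_subset (mkSite2 (a' - 1) (b' - 1)) (rectWindow a' b'))) LB))).PosSemidef) :
    (((q : ℝ) * Real.log q - ∑ s ∈ S, (m s : ℝ) * Real.log (m s) + ∑ s ∈ S, (m s : ℝ) * Real.log (z s)) /
        ((q : ℝ) * a * b) - (c - βc * μ * n)) / (βc - β) ≤
      ω.meanEnergy (hubbardTTPrimeFermionInteraction t 0 U) 1 := by
  refine h.le_meanEnergy_hubbardTTPrime_of_eventually_pressure_bounds hn0 hn2 hLs hβ hlt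
    (fun ε hε => eventually_typeFreeEntropy_mul_sq_le_log_partitionFn_allTori t 0 U n hβ.le ha hb S m hq hmS
      hsum hA hB hn hn2 hz0 hz hLs hε)
    (fun ε hε => ?_)
  have hKTI : ∀ (L : ℕ) [NeZero L], ∀ w : TorusSite 2 L,
      relabel (Orb.translate w) (hubbardTorusTT' L t 0 U - (μ : ℂ) • totalNumber) =
        hubbardTorusTT' L t 0 U - (μ : ℂ) • totalNumber := fun L _ w => by
    rw [hubbardTorusTT'_zero_sub_mu, relabel_translate_hubbardTorusWith]
  exact eventually_log_partitionFn_sectorHamiltonianTT'_le_of_clusterCertificate t U μ βc hn0 hn2 hLs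
    (rectCorner_mem_rectWindow (by omega) (by omega)) toLex_le_toLex_rectCorner
    (rectWindow_subset_halfOpenBox_max a' b')
    (fun i => bondWeightSum_cornerBondWeight (rectCorner_mem_rectWindow (by omega) (by omega))
      (rectCorner_sub_unitVec_mem_rectWindow ha' hb' i))
    (siteWeightSum_cornerSiteWeight (rectCorner_mem_rectWindow (by omega) (by omega)))
    (siteWeightSum_mul_cornerSiteWeight (rectCorner_mem_rectWindow (by omega) (by omega)) (-μ))
    (isHermitian_windowAnnihilator sι _ Sw hS zw hzw hO g)
    (fun L _ hL3 hℓL => trace_window_mul_windowAnnihilator (relabel_translate_gibbsDensity L (hKTI L) βc)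
      _ sι Sw hS zw hzw O g) hLB hcert hε

end InfVolFermionState

end Literature.MathematicalPhysics.QuantumLattice

end
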